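import Summits.ResolutionOfSingularities.ResolutionOfSingularities.Theorems.PurelyInseparableDim4ScopeWitness
import Summits.ResolutionOfSingularities.ResolutionOfSingularities.Theorems.PurelyInseparableDim4EquimultipleScope
import Summits.ResolutionOfSingularities.ResolutionOfSingularities.Theorems.PurelyInseparableDim4StepKitF9
import Summits.ResolutionOfSingularities.ResolutionOfSingularities.Theorems.PurelyInseparableDim4LoopERegion
import Literature.AlgebraicGeometry.Resolution.DiffStableAdjoin
import Mathlib.RingTheory.Polynomial.UniqueFactorization
import HarnessLib

/-!
# The COAT LEMMA: `x_k^{q−1}·U` is OUT of coordinate scope when `U|_{x_k=0}` vanishes at the origin and no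
# coordinate divides it — a curve-free, field-generic blindness criterion (cell `res-dim4-pi`, scope column)

[OURS · counted 0 · frame bookkeeping] Nothing here is a statement about resolution of singularities.
Seat res-dim4-p-8 g3 («𝔽₉ lane», WORD #72).  The cell certifies `¬ InCoordinateScope q F` (BLIND states: some
component of the `q`-fold locus through the origin is not a coordinate subspace) by CURVES inside `V(J_q⁺(F))` —
monomial (`ScopeBlind.blindB`), rational (`rblindB`), both `decide`-driven and one field at a time (then pushed up
along field maps).  The `√−1` children of LOOP-E (`…LoopELocalEscapeSqrt`) and res-dim4-p-14's scope-loss leaves are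
all of ONE shape — a COAT: `F = x_k^{q−1} · U` with `U(0) = 0` — and for coats blindness is STRUCTURAL:

* §1 `hasseDeriv_coat_mem_span`: every Hasse derivative of order `< q` of `x_k^{q−1}·U` lies in the ideal `(x_k, U)`
  (higher Leibniz rule, the tree's `Literature.AlgebraicGeometry.Resolution.hasseDeriv_mul`; only the term `D^{((q−1)e_k)}x_k^{q−1} · U = U`
  escapes `(x_k)`), and `kill_hasseDeriv_coat_top`: `D^{((q−1)e_k)}F ≡ U (mod x_k)`;
* §2 **`not_inCoordinateScope_coat`** (any field `K`, any `q ≥ 2`): if `Ū := U(x_k ↦ 0) ≠ 0`, `Ū(0) = 0`, and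
  `x_i ∤ Ū` for every `i ≠ k`, then `¬ InCoordinateScope q (x_k^{q−1}·U)`.  Proof: a prime factor `g` of `Ū` with
  `g(0) = 0` exists (`K[x]` is factorial); `Q = ker (K[x] → K[x]/(g) ∘ (x_k ↦ 0))` is a prime with
  `J_q⁺ ≤ (x_k, U) ≤ Q ≤ 𝔪₀` containing no `x_i`, `i ≠ k` (else `g ∼ x_i ∣ Ū`), while `J_q⁺ ⊄ (x_k)` by §1 — then
  res-dim4-p-3's `IsolationCert.not_inCoordinateScope_of_prime`.  NO curve, NO point, NO `decide`: usable for
  PARAMETRIC families (children depending on `β ∈ L`) as long as the three support conditions on `Ū` hold uniformly;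
* §3 the decidable instance for presented states (`StepKit.SData`): hypotheses `equivB`, `evalAtL`, `live` that `decide`
  discharges (`not_inCoordinateScope_of_coat_checks`, def-free), and the ACCEPTANCE: LOOP-E's four `√−1` children over
  `F9` are coats (`coat_e3_x1` …) — a second, curve-free certificate of `…LoopELocalEscapeSqrt`'s blind leaves.

OURS; counted 0.  bears_on: LADDER-RESOLUTION:D157-DOOR2 (res-dim4-pi · frame v4 scope column · ∀K blindness).  Supports
stmt-ResolutionOfSingularities-16155 (helper).
-/

set_option linter.dupNamespace false -- mandated namespace of this single-conjunct summit

noncomputable section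

open MvPolynomial Finset
open scoped BigOperators

namespace Summit.ResolutionOfSingularities.ResolutionOfSingularities.Theorems.PIDim4

namespace ScopeBlind

open Literature.AlgebraicGeometry.Resolution
open StepKit

variable {K : Type} [Field K]

/-! ## §1 Hasse derivatives of a coat -/

/-- **Hasse derivatives of a coat stay in `(x_k, U)`**: for `|α| < q`,
`D^{(α)}(x_k^{q−1}·U) ∈ (x_k, U)`. [cite: EGAIV4, Thm. 16.11.2 (Leibniz rule (16.11.2.2))] -/
theorem hasseDeriv_coat_mem_span (q : ℕ) (k : Fin 4) (U : MvPolynomial (Fin 4) K) {α : Fin 4 →₀ ℕ}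
    (hαq : α.degree < q) :
    hasseDeriv α ((X k : MvPolynomial (Fin 4) K) ^ (q - 1) * U) ∈
      Ideal.span ({(X k : MvPolynomial (Fin 4) K), U} : Set (MvPolynomial (Fin 4) K)) := by
  classical
  have hXk : (X k : MvPolynomial (Fin 4) K) ∈ Ideal.span ({(X k : MvPolynomial (Fin 4) K), U} : Set _) :=
    Ideal.subset_span (by simp)
  have hU : U ∈ Ideal.span ({(X k : MvPolynomial (Fin 4) K), U} : Set _) := Ideal.subset_span (by simp)
  rw [Equimultiple.hasseDeriv_eq, Literature.AlgebraicGeometry.Resolution.hasseDeriv_mul]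
  refine Ideal.sum_mem _ fun p hp => ?_
  rw [Finset.HasAntidiagonal.mem_antidiagonal] at hp
  by_cases hβ : p.1 = Finsupp.single k (p.1 k)
  · rw [hβ, Literature.AlgebraicGeometry.Resolution.hasseDeriv_X_pow]
    by_cases hlt : p.1 k < q - 1
    · -- a positive power of `x_k` survives
      refine Ideal.mul_mem_right _ _ (Ideal.mul_mem_left _ _ ?_)
      exact Ideal.pow_mem_of_mem _ hXk _ (Nat.sub_pos_of_lt hlt)
    · -- `β_k ≥ q − 1` forces `γ = 0`: the term is a multiple of `U`
      have hγ : p.2 = 0 := by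
        have hdeg : (p.1).degree + (p.2).degree = α.degree := by rw [← map_add, hp]
        have h1 : q - 1 ≤ (p.1).degree := le_trans (not_lt.mp hlt) (Finsupp.le_degree k p.1)
        have h2 : (p.2).degree = 0 := by omega
        exact (Finsupp.degree_eq_zero_iff _).mp h2
      rw [hγ, Literature.AlgebraicGeometry.Resolution.hasseDeriv_zero_apply]
      exact Ideal.mul_mem_left _ _ hU
  · rw [Literature.AlgebraicGeometry.Resolution.hasseDeriv_X_pow_of_ne k (q - 1) hβ, zero_mul]
    exact Ideal.zero_mem _

/-- **`J_q⁺` of a coat lies in `(x_k, U)`.** [folklore] -/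
theorem singLocusIdeal_coat_le_span (q : ℕ) (k : Fin 4) (U : MvPolynomial (Fin 4) K) :
    singLocusIdeal q ((X k : MvPolynomial (Fin 4) K) ^ (q - 1) * U) ≤
      Ideal.span ({(X k : MvPolynomial (Fin 4) K), U} : Set (MvPolynomial (Fin 4) K)) := by
  unfold singLocusIdeal
  rw [Ideal.span_le]
  rintro _ ⟨α, -, hαq, rfl⟩
  exact hasseDeriv_coat_mem_span q k U hαq

/-! ### the substitution `x_k ↦ 0` -/

/-- `x_k ↦ 0` kills `x_k`. [folklore] -/
theorem aeval_kill_X_self (k : Fin 4) :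
    MvPolynomial.aeval (R := K) (fun i : Fin 4 => if i = k then (0 : MvPolynomial (Fin 4) K) else X i)
      (X k : MvPolynomial (Fin 4) K) = 0 := by
  rw [MvPolynomial.aeval_X, if_pos rfl]

/-- `x_k ↦ 0` fixes the other coordinates. [folklore] -/
theorem aeval_kill_X_ne {k i : Fin 4} (h : i ≠ k) :
    MvPolynomial.aeval (R := K) (fun i : Fin 4 => if i = k then (0 : MvPolynomial (Fin 4) K) else X i)
      (X i : MvPolynomial (Fin 4) K) = X i := by
  rw [MvPolynomial.aeval_X, if_neg h]

/-- evaluation at the origin does not see the substitution `x_k ↦ 0`. [folklore] -/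
theorem eval_zero_aeval_kill (k : Fin 4) (f : MvPolynomial (Fin 4) K) :
    MvPolynomial.eval (0 : Fin 4 → K)
        (MvPolynomial.aeval (R := K) (fun i : Fin 4 => if i = k then (0 : MvPolynomial (Fin 4) K) else X i) f) =
      MvPolynomial.eval (0 : Fin 4 → K) f := by
  have h : (MvPolynomial.eval (0 : Fin 4 → K)).comp
      (MvPolynomial.aeval (R := K) (fun i : Fin 4 => if i = k then (0 : MvPolynomial (Fin 4) K) else X i)).toRingHom =
        MvPolynomial.eval (0 : Fin 4 → K) := by
    refine MvPolynomial.ringHom_ext (fun r => ?_) (fun i => ?_)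
    · simp
    · simp only [RingHom.comp_apply, AlgHom.toRingHom_eq_coe, AlgHom.coe_toRingHom, MvPolynomial.aeval_X,
        eval_X, Pi.zero_apply]
      split_ifs <;> simp
  exact congrArg (fun φ : MvPolynomial (Fin 4) K →+* K => φ f) h

/-- **`D^{((q−1)e_k)}(x_k^{q−1}·U) ≡ U (mod x_k)`**: after `x_k ↦ 0` the top `x_k`-derivative of the coat is `Ū`.
[cite: EGAIV4, Thm. 16.11.2 (16.11.2.2)] -/
theorem kill_hasseDeriv_coat_top (q : ℕ) (k : Fin 4) (U : MvPolynomial (Fin 4) K) :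
    MvPolynomial.aeval (R := K) (fun i : Fin 4 => if i = k then (0 : MvPolynomial (Fin 4) K) else X i)
        (hasseDeriv (Finsupp.single k (q - 1)) ((X k : MvPolynomial (Fin 4) K) ^ (q - 1) * U)) =
      MvPolynomial.aeval (R := K) (fun i : Fin 4 => if i = k then (0 : MvPolynomial (Fin 4) K) else X i) U := by
  classical
  set κ := MvPolynomial.aeval (R := K) (fun i : Fin 4 => if i = k then (0 : MvPolynomial (Fin 4) K) else X i)
    with hκ
  rw [Equimultiple.hasseDeriv_eq, Literature.AlgebraicGeometry.Resolution.hasseDeriv_mul, map_sum]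
  rw [Finset.sum_eq_single (Finsupp.single k (q - 1), (0 : Fin 4 →₀ ℕ))]
  · dsimp only
    rw [Literature.AlgebraicGeometry.Resolution.hasseDeriv_zero_apply,
      Literature.AlgebraicGeometry.Resolution.hasseDeriv_X_pow, Nat.choose_self, Nat.sub_self, pow_zero, Nat.cast_one,
      one_mul, one_mul]
  · rintro ⟨β, γ⟩ hp hne
    rw [Finset.HasAntidiagonal.mem_antidiagonal] at hp
    dsimp only at hp ⊢
    change κ (Literature.AlgebraicGeometry.Resolution.hasseDeriv K β ((X k : MvPolynomial (Fin 4) K) ^ (q - 1)) * Literature.AlgebraicGeometry.Resolution.hasseDeriv K γ U) = 0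
    by_cases hβ : β = Finsupp.single k (β k)
    · rw [hβ, Literature.AlgebraicGeometry.Resolution.hasseDeriv_X_pow]
      rcases lt_trichotomy (β k) (q - 1) with hlt | heq | hgt
      · -- a positive power of `x_k` is killed
        rw [map_mul, map_mul, map_pow, hκ, aeval_kill_X_self, zero_pow (Nat.sub_ne_zero_of_lt hlt), mul_zero,
          zero_mul]
      · -- `β = (q−1)e_k` forces `γ = 0`: this is the excluded term
        exfalso
        apply hne
        have hβ' : β = Finsupp.single k (q - 1) := by rw [hβ, heq]
        have hγ : γ = 0 := by
          have := hp
          rw [hβ'] at this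
          exact add_left_cancel (a := Finsupp.single k (q - 1)) (this.trans (add_zero _).symm)
        rw [hβ', hγ]
      · rw [Nat.choose_eq_zero_of_lt hgt, Nat.cast_zero, zero_mul, zero_mul, map_zero]
    · rw [Literature.AlgebraicGeometry.Resolution.hasseDeriv_X_pow_of_ne k (q - 1) hβ, zero_mul, map_zero]
  · intro h
    exact absurd (Finset.HasAntidiagonal.mem_antidiagonal.mpr (add_zero _)) h

/-! ## §2 The coat lemma -/

/-- a non-zero polynomial vanishing at the origin has a PRIME factor vanishing at the origin (`K[x]` is factorial).
[cite: AtiyahMacdonald1969, Ch. 1 (prime ideals)] [folklore] -/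
theorem exists_prime_dvd_eval_zero {P : MvPolynomial (Fin 4) K} (hP : P ≠ 0)
    (h0 : MvPolynomial.eval (0 : Fin 4 → K) P = 0) :
    ∃ g : MvPolynomial (Fin 4) K, Prime g ∧ g ∣ P ∧ MvPolynomial.eval (0 : Fin 4 → K) g = 0 := by
  classical
  obtain ⟨u, hu⟩ := UniqueFactorizationMonoid.factors_prod hP
  have h1 : MvPolynomial.eval (0 : Fin 4 → K) (UniqueFactorizationMonoid.factors P).prod = 0 := by
    have h := congrArg (MvPolynomial.eval (0 : Fin 4 → K)) hu
    rw [map_mul, h0] at h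
    have hu0 : MvPolynomial.eval (0 : Fin 4 → K) (↑u : MvPolynomial (Fin 4) K) ≠ 0 :=
      (u.isUnit.map (MvPolynomial.eval (0 : Fin 4 → K))).ne_zero
    exact (mul_eq_zero.mp h).resolve_right hu0
  rw [map_multiset_prod, Multiset.prod_eq_zero_iff, Multiset.mem_map] at h1
  obtain ⟨g, hg, hg0⟩ := h1
  exact ⟨g, UniqueFactorizationMonoid.prime_of_factor g hg, UniqueFactorizationMonoid.dvd_of_mem_factors hg, hg0⟩

/-- **THE COAT LEMMA.**  Let `F = x_k^{q−1} · U` (`q ≥ 2`) and `Ū = U(x_k ↦ 0)`.  If `Ū ≠ 0`, `Ū(0) = 0`, and no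
coordinate `x_i` (`i ≠ k`) divides `Ū`, then `F` is OUT of coordinate scope: the `q`-fold locus has the non-coordinate
component `{x_k = 0, g = 0}` through the origin, `g` a prime factor of `Ū` vanishing there.  Curve-free and valid over
every field. OURS. [cite: AtiyahMacdonald1969, Ch. 1 (prime ideals; minimal primes, Ex. 1.8)] -/
theorem not_inCoordinateScope_coat {q : ℕ} (hq : 2 ≤ q) (k : Fin 4) (U : MvPolynomial (Fin 4) K)
    (hne : MvPolynomial.aeval (R := K) (fun i : Fin 4 => if i = k then (0 : MvPolynomial (Fin 4) K) else X i) U ≠ 0)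
    (h0 : MvPolynomial.eval (0 : Fin 4 → K) U = 0)
    (hX : ∀ i : Fin 4, i ≠ k →
      ¬ ((X i : MvPolynomial (Fin 4) K) ∣
        MvPolynomial.aeval (R := K) (fun i : Fin 4 => if i = k then (0 : MvPolynomial (Fin 4) K) else X i) U)) :
    ¬ InCoordinateScope q ((X k : MvPolynomial (Fin 4) K) ^ (q - 1) * U) := by
  classical
  set κ := MvPolynomial.aeval (R := K) (fun i : Fin 4 => if i = k then (0 : MvPolynomial (Fin 4) K) else X i)
    with hκ
  -- a prime factor of `Ū` through the origin
  have hε : MvPolynomial.eval (0 : Fin 4 → K) (κ U) = 0 := by rw [hκ, eval_zero_aeval_kill]; exact h0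
  obtain ⟨g, hg, hgU, hg0⟩ := exists_prime_dvd_eval_zero hne hε
  -- the prime `Q = ker (mk_(g) ∘ κ)`
  let I : Ideal (MvPolynomial (Fin 4) K) := Ideal.span {g}
  haveI hI : I.IsPrime := (Ideal.span_singleton_prime hg.ne_zero).mpr hg
  let φ : MvPolynomial (Fin 4) K →+* MvPolynomial (Fin 4) K ⧸ I := (Ideal.Quotient.mk I).comp κ.toRingHom
  have hφ : ∀ f, φ f = Ideal.Quotient.mk I (κ f) := fun f => rfl
  refine IsolationCert.not_inCoordinateScope_of_prime (P := RingHom.ker φ) (RingHom.ker_isPrime φ) ?_ ?_ {k} ?_ ?_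
  · -- `J ≤ (x_k, U) ≤ ker φ`
    refine (singLocusIdeal_coat_le_span q k U).trans ?_
    rw [Ideal.span_le]
    intro f hf
    simp only [Set.mem_insert_iff, Set.mem_singleton_iff] at hf
    rw [SetLike.mem_coe, RingHom.mem_ker, hφ]
    rcases hf with rfl | rfl
    · rw [hκ, aeval_kill_X_self, map_zero]
    · exact Ideal.Quotient.eq_zero_iff_mem.mpr (Ideal.mem_span_singleton.mpr hgU)
  · -- `ker φ ≤ 𝔪₀`
    intro f hf
    rw [RingHom.mem_ker, hφ] at hf
    obtain ⟨h, hh⟩ := Ideal.mem_span_singleton'.mp (Ideal.Quotient.eq_zero_iff_mem.mp hf)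
    unfold originIdeal
    rw [RingHom.mem_ker, ← eval_zero_aeval_kill k f, ← hκ, ← hh, map_mul, hg0, mul_zero]
  · -- no `x_i`, `i ≠ k`, in `ker φ`
    intro i hi
    rw [Finset.mem_singleton]
    by_contra hik
    rw [RingHom.mem_ker, hφ, hκ, aeval_kill_X_ne hik] at hi
    have hgX : g ∣ (X i : MvPolynomial (Fin 4) K) :=
      Ideal.mem_span_singleton.mp (Ideal.Quotient.eq_zero_iff_mem.mp hi)
    have hass : Associated g (X i) := hg.irreducible.associated_of_dvd MvPolynomial.X_prime.irreducible hgX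
    exact hX i hik (hass.dvd_iff_dvd_left.mp hgU)
  · -- `J ⊄ (x_k)`: the top `x_k`-derivative is `Ū ≠ 0` modulo `x_k`
    intro hle
    have hq1 : 0 < (Finsupp.single k (q - 1)).degree := by rw [Finsupp.degree_single]; omega
    have hq2 : (Finsupp.single k (q - 1)).degree < q := by rw [Finsupp.degree_single]; omega
    have hD : hasseDeriv (Finsupp.single k (q - 1)) ((X k : MvPolynomial (Fin 4) K) ^ (q - 1) * U) ∈
        singLocusIdeal q ((X k : MvPolynomial (Fin 4) K) ^ (q - 1) * U) :=
      Ideal.subset_span ⟨Finsupp.single k (q - 1), hq1, hq2, rfl⟩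
    have hmem := hle hD
    rw [Finset.coe_singleton, Set.image_singleton, Ideal.mem_span_singleton'] at hmem
    obtain ⟨h, hh⟩ := hmem
    apply hne
    rw [← kill_hasseDeriv_coat_top q k U, ← hh, map_mul, ← hκ]
    rw [hκ, aeval_kill_X_self, mul_zero]

/-! ## §3 Presented states: `decide`-able coat hypotheses, and LOOP-E's `√−1` children as coats -/

section Presented

variable [DecidableEq K]

omit [DecidableEq K] in
/-- `x_k ↦ 0` on a presented polynomial keeps exactly the terms without `x_k`. [folklore] -/
theorem aeval_kill_evalT (k : Fin 4) (L : Terms 4 K) :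
    MvPolynomial.aeval (R := K) (fun i : Fin 4 => if i = k then (0 : MvPolynomial (Fin 4) K) else X i) (evalT L) =
      evalT (L.filter fun t => t.1 k = 0) := by
  induction L with
  | nil => simp
  | cons t L ih =>
    rw [evalT_cons, map_add, ih, List.filter_cons]
    have hmon : MvPolynomial.aeval (R := K) (fun i : Fin 4 => if i = k then (0 : MvPolynomial (Fin 4) K) else X i)
        (monomial (expo t.1) t.2) = if t.1 k = 0 then monomial (expo t.1) t.2 else 0 := by
      rw [monomial_expo_eq, map_mul, MvPolynomial.algHom_C, MvPolynomial.algebraMap_eq, map_prod]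
      simp only [map_pow, MvPolynomial.aeval_X]
      split_ifs with h
      · congr 1
        refine Finset.prod_congr rfl fun i _ => ?_
        by_cases hik : i = k
        · subst hik; rw [if_pos rfl, h, pow_zero, pow_zero]
        · rw [if_neg hik]
      · rw [Finset.prod_eq_zero (Finset.mem_univ k) (by rw [if_pos rfl]; exact zero_pow h), mul_zero]
    rw [hmon]
    by_cases h : t.1 k = 0
    · rw [if_pos h]; simp [h]
    · rw [if_neg h, zero_add]; simp [h]

/-- a live exponent with `e_i = 0` forbids `x_i ∣ evalT L`. [folklore] -/
theorem not_X_dvd_evalT_of_live {L : Terms 4 K} {i : Fin 4} {e : Fin 4 → ℕ} (he : e ∈ live L) (hei : e i = 0) :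
    ¬ ((X i : MvPolynomial (Fin 4) K) ∣ evalT L) := by
  classical
  rintro ⟨Q, hQ⟩
  have hsupp : expo e ∈ (evalT L).support := (expo_mem_support_iff L e).mpr he
  rw [MvPolynomial.mem_support_iff, hQ, MvPolynomial.coeff_X_mul'] at hsupp
  apply hsupp
  rw [if_neg]
  rw [Finsupp.mem_support_iff, not_not]
  exact hei

/-- **Coat hypotheses on a presented state, `decide`-able**: `s.L ≡ x_k^{q−1} · Ls` (as polynomials), the `x_k`-free
part `Ū` of `Ls` is non-zero, vanishes at the origin, and for every `i ≠ k` shows a live exponent with `e_i = 0` ⇒ the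
state is OUT of coordinate scope (def-free wrapper of `not_inCoordinateScope_coat`). OURS. [folklore] -/
theorem not_inCoordinateScope_of_coat_checks {q : ℕ} (hq : 2 ≤ q) (s : SData 4 K) (k : Fin 4) (Ls : Terms 4 K)
    (hL : equivB (mulTL ((fun l : Fin 4 => if l = k then q - 1 else 0), (1 : K)) Ls) s.L = true)
    (hne : equivB (Ls.filter fun t => t.1 k = 0) [] = false)
    (h0 : evalAtL (0 : Fin 4 → K) (Ls.filter fun t => t.1 k = 0) = 0)
    (hX : ∀ i : Fin 4, i ≠ k → ∃ e ∈ live (Ls.filter fun t => t.1 k = 0), e i = 0) :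
    ¬ InCoordinateScope q s.toState.F := by
  classical
  have hmono : monomial (expo fun l : Fin 4 => if l = k then q - 1 else 0) (1 : K) =
      (X k : MvPolynomial (Fin 4) K) ^ (q - 1) := by
    rw [monomial_expo_eq, C_1, one_mul, Fin.prod_univ_four]
    fin_cases k <;> simp
  have hF : s.toState.F = (X k : MvPolynomial (Fin 4) K) ^ (q - 1) * evalT Ls := by
    rw [SData.toState_F, ← (evalT_eq_iff_equivB _ _).mpr hL, evalT_mulTL, ← hmono]
  rw [hF]
  refine not_inCoordinateScope_coat hq k (evalT Ls) ?_ ?_ ?_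
  · rw [aeval_kill_evalT, Ne, evalT_eq_zero_iff, hne]
    exact Bool.false_ne_true
  · rw [← eval_zero_aeval_kill k, aeval_kill_evalT, eval_evalT, h0]
  · intro i hik
    obtain ⟨e, he, hei⟩ := hX i hik
    rw [aeval_kill_evalT]
    exact not_X_dvd_evalT_of_live he hei

/-! ### Acceptance: LOOP-E's `√−1` children over `F9` are coats (curve-free second certificate) -/

open StepKit.F9 LoopC

/-- the `x₁`-chart `√−1` child of `e3` (point `(0,0,i,0)`) is a coat in `x₁`: OUT of coordinate scope, by the four
`decide`-able coat checks — a curve-free second certificate of `LoopCLocal.rblind_e3_x1`. [OURS · ‖ K over `F9`] -/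
theorem coat_e3_x1 :
    ¬ InCoordinateScope 3 (stepD 3 {0, 2} 0 ![0, 0, i, 0] e3.castF9).toState.F :=
  not_inCoordinateScope_of_coat_checks (by norm_num) _ 0
    ((stepD 3 {0, 2} 0 ![0, 0, i, 0] e3.castF9).L.map fun t => (fun l => if l = 0 then t.1 l - 2 else t.1 l, t.2))
    (by decide +kernel) (by decide +kernel) (by decide +kernel) (by decide +kernel)

/-- the `x₃`-chart `√−1` child of `e3` is a coat in `x₃`. [OURS · ‖ K over `F9`] -/
theorem coat_e3_x3 :
    ¬ InCoordinateScope 3 (stepD 3 {0, 2} 2 ![i, 0, 0, 0] e3.castF9).toState.F :=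
  not_inCoordinateScope_of_coat_checks (by norm_num) _ 2
    ((stepD 3 {0, 2} 2 ![i, 0, 0, 0] e3.castF9).L.map fun t => (fun l => if l = 2 then t.1 l - 2 else t.1 l, t.2))
    (by decide +kernel) (by decide +kernel) (by decide +kernel) (by decide +kernel)

/-- the `x₁`-chart `√−1` child of `g3` (LOOP-E′) is a coat in `x₁`. [OURS · ‖ K over `F9`] -/
theorem coat_g3_x1 :
    ¬ InCoordinateScope 3 (stepD 3 {0, 2} 0 ![0, 0, i, 0] g3.castF9).toState.F :=
  not_inCoordinateScope_of_coat_checks (by norm_num) _ 0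
    ((stepD 3 {0, 2} 0 ![0, 0, i, 0] g3.castF9).L.map fun t => (fun l => if l = 0 then t.1 l - 2 else t.1 l, t.2))
    (by decide +kernel) (by decide +kernel) (by decide +kernel) (by decide +kernel)

/-- the `x₃`-chart `√−1` child of `g3` is a coat in `x₃`. [OURS · ‖ K over `F9`] -/
theorem coat_g3_x3 :
    ¬ InCoordinateScope 3 (stepD 3 {0, 2} 2 ![i, 0, 0, 0] g3.castF9).toState.F :=
  not_inCoordinateScope_of_coat_checks (by norm_num) _ 2
    ((stepD 3 {0, 2} 2 ![i, 0, 0, 0] g3.castF9).L.map fun t => (fun l => if l = 2 then t.1 l - 2 else t.1 l, t.2))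
    (by decide +kernel) (by decide +kernel) (by decide +kernel) (by decide +kernel)

end Presented

end ScopeBlind

end Summit.ResolutionOfSingularities.ResolutionOfSingularities.Theorems.PIDim4

end
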